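import Literature.Analysis.FluidPDE.DuchonRobert
import Literature.Analysis.FluidPDE.TorusClassicalLerayHopfProofs
import HarnessLib

/-!
# `lions_energy_equality` is false as stated: the `t = 0` slice is junk

Refutation file (theorem-only) for the named fact
`Literature.Analysis.FluidPDE.lions_energy_equality` (`FluidPDE/DuchonRobert`, turb.S23; cited
there to J.-L. Lions 1960 and Shinbrot 1974).

The fact concludes the energy equality
`½‖u(t)‖² + ν∫₀ᵗ‖∇u‖₂² = ½‖u₀‖² + ∫₀ᵗ∫⟪f, u⟫` for **every** `t ∈ Icc 0 T`. At `t = 0` both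
integrals run over `Ioo 0 0 = ∅` / `0..0` and the identity reads
`kineticEnergy (u 0) = kineticEnergy u₀`. But no clause of the accepted
`Torus.IsLerayHopfOn T ν f u₀ u` constrains the time slice `u 0`: the weak formulation
(`Torus.IsWeakNSSolutionForcedOn`) sees `u` only under `∫ t in Ioo 0 T` and `∀ᵐ t`, the fields
`energy_bound`, `memL2Sobolev`, `energy_ineq_ae` are a.e. in time, `weak_continuous` and
`strong_initial` are statements on `Ioc 0 T` and along `𝓝[>] 0`, `memLp` only asks
`u 0 ∈ L²`, and `energy_ineq_zero` at `t = 0` only asks `kineticEnergy (u 0) ≤ kineticEnergy u₀`.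
Hence redefining `u 0 := 0` preserves every hypothesis of the fact and breaks its conclusion as
soon as `u₀ ≠ 0`. In the printed theorems (Lions 1960; Shinbrot 1974; Beirão da Veiga–Yang 2020,
Thm. 1.1: energy equality "for any `t₀ ∈ [0,T)`") the solution is the weakly `L²`-continuous
representative with `u(0) = u₀`, so that the case `t₀ = 0` is the tautology `‖u₀‖² = ‖u₀‖²`;
the vendored rendering dropped this identification.

The witness is the **jump flow** `t ↦ (x ↦ if t = 0 then 0 else c)` (written as an explicit
lambda; the file is theorem-only): the steady constant flow `c` with the slice `t = 0` redefined to `0`.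

* `Literature.Analysis.FluidPDE.isLerayHopfOn_jumpFlow` — the jump flow is a Leray–Hopf solution
  on the degenerate horizon `T^d × [0, 0]` with datum the constant field `c`, any viscosity, zero
  force (every clause is an integral over `Ioo 0 0 = ∅`, an a.e. statement for the zero
  measure, or a statement about times `t > 0`, where the flow is the constant `c`);
* `Literature.Analysis.FluidPDE.not_lions_energy_equality` — for `c ≠ 0` and `ν ≥ 0` the
  instance `T = 0`, `f = 0`, `u =` the jump flow, `u₀ = c` of `lions_energy_equality` is false (all
  hypotheses hold, `u ∈ L⁴(∅; L⁴)`, `f ∈ L¹(∅; L²)` trivially, and the conclusion at `t = 0`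
  says `0 = ½‖c‖²`); `Literature.Analysis.FluidPDE.not_forall_lions_energy_equality` — hence the
  universal closure of the fact over its implicit arguments (the statement a discharge
  `lions_energy_equality_holds : lions_energy_equality` would have to prove) fails on `T³`,
  `ν = 1`;
* the degenerate horizon only keeps the witness elementary:
  `Literature.Analysis.FluidPDE.isClassicalNSSolutionOn_const`,
  `Literature.Analysis.FluidPDE.isLerayHopfOn_const` (the steady constant flow is a classical,
  hence Leray–Hopf, solution on `[0, T)` for every `T > 0`, by the tree's
  `Torus.IsClassicalNSSolutionOn.isLerayHopfOn_of_convex`),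
  `Literature.Analysis.FluidPDE.isLerayHopfOn_jumpFlow_of_pos` (so is the jump flow, which
  differs from it only on the slice `t = 0`), and
  `Literature.Analysis.FluidPDE.not_lions_energy_equality_of_pos`,
  `Literature.Analysis.FluidPDE.not_forall_lions_energy_equality_pos`: the fact fails for
  **every** `T > 0` (on `T³`, `ν = 1`, `T = 1`), since the slice `t = 0` is never constrained.

The corrected statement (conclusion for `t ∈ Ioc 0 T`, datum in `L²`, jointly measurable force)
is the genuine Lions–Shinbrot theorem, proved in tree as
`Literature.Analysis.FluidPDE.lions_energy_equality_Ioc` (`FluidPDE/DuchonRobertLionsEnergyEquality`,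
`2 ≤ d ≤ 4`) and `Literature.Analysis.FluidPDE.lions_energy_equality_Ioc'`
(`FluidPDE/DuchonRobertLionsEnergyEqualityGeneral`, every finite `d`); the refuted record itself
is kept byte-for-byte under `@[deprecated]` in `FluidPDE/DuchonRobert` (verdict clean-up
2026-08-16), which is why `linter.deprecated` is switched off for the four theorems below that
must name it.

## References

* J.-L. Lions, *Sur la régularité et l'unicité des solutions turbulentes des équations de Navier
  Stokes*, Rend. Sem. Mat. Univ. Padova 30 (1960), 16–23.
* M. Shinbrot, *The energy equation for the Navier–Stokes system*, SIAM J. Math. Anal. 5 (1974),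
  948–954. [Shinbrot1974]
* H. Beirão da Veiga, J. Yang, *On the Shinbrot's criteria for energy equality to Newtonian
  fluids: a simplified proof, and an extension of the range of application*, Nonlinear Anal. 196
  (2020) = arXiv:1912.10249, Thm. 1.1.
-/

noncomputable section

open MeasureTheory TopologicalSpace Set Function Filter Topology
open scoped InnerProductSpace RealInnerProductSpace ENNReal NNReal

namespace Literature.Analysis.FluidPDE

variable {d : Type*} [Fintype d] [DecidableEq d]

/-! ### The witness -/

omit [DecidableEq d] in
/-- The guarded mixed class `L^q(∅; L^p)` contains every field. [folklore] -/
theorem memLqLp_Ioo_self (q p : ℝ≥0∞) (v : ℝ → UnitAddTorus d → EuclideanSpace ℝ d) (a : ℝ) :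
    Torus.MemLqLp q p v (Ioo a a) := by
  refine ⟨?_, ?_⟩
  · rw [Ioo_self, Measure.restrict_empty, ae_zero]
    exact eventually_bot
  · rw [FluidPDE.eLqLpNorm_def, Ioo_self, Measure.restrict_empty, eLpNorm_measure_zero]
    exact ENNReal.zero_lt_top

/-- **The jump flow is a Leray–Hopf solution on the degenerate horizon `[0, 0]`** with datum the
constant field `c`, any viscosity `ν` and zero force: every clause of `Torus.IsLerayHopfOn 0 ν 0`
is an integral over `Ioo 0 0 = ∅`, an a.e. statement for the zero measure, the membership
`u 0 = 0 ∈ L²`, the inequality `0 ≤ ½‖c‖²`, or a statement about times `t > 0` where the flow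
is the constant `c` (weak `L²` continuity and strong attainment of the datum at `0⁺`); the weak
formulation holds because test fields on `[0, 0)` vanish at `t = 0`. [folklore] -/
theorem isLerayHopfOn_jumpFlow (ν : ℝ) (c : EuclideanSpace ℝ d) :
    Torus.IsLerayHopfOn 0 ν 0 (fun _ => c) (fun (t : ℝ) (_ : UnitAddTorus d) => if t = 0 then (0 : EuclideanSpace ℝ d) else c) where
  weak := by
    refine ⟨?_, ?_, ?_, ?_⟩
    · rw [Ioo_self, empty_prod, Measure.restrict_empty]
      exact aestronglyMeasurable_zero_measure _
    · rw [Ioo_self, Measure.restrict_empty, lintegral_zero_measure]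
      exact ENNReal.zero_lt_top
    · rw [Ioo_self, Measure.restrict_empty, ae_zero]
      exact eventually_bot
    · intro ψ hψ _
      obtain ⟨T', hT', h0⟩ := hψ.2
      have hψ0 : ψ 0 = 0 := h0 0 hT'.le
      rw [Ioo_self, Measure.restrict_empty, integral_zero_measure, hψ0]
      simp
  energy_bound := ⟨0, by
    rw [Ioo_self, Measure.restrict_empty, ae_zero]
    exact eventually_bot⟩
  memLp := fun t _ => memLp_const _
  memL2Sobolev := by
    refine ⟨?_, ?_⟩
    · rw [Ioo_self, Measure.restrict_empty, ae_zero]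
      exact eventually_bot
    · rw [FunctionSpaces.Torus.eL2SobolevNorm, Ioo_self, Measure.restrict_empty,
        lintegral_zero_measure, ENNReal.zero_rpow_of_pos (by norm_num)]
      exact ENNReal.zero_lt_top
  energy_ineq_zero := by
    intro t ht
    obtain rfl : t = 0 := le_antisymm ht.2 ht.1
    have h1 : FunctionSpaces.Torus.kineticEnergy ((fun (t : ℝ) (_ : UnitAddTorus d) => if t = 0 then (0 : EuclideanSpace ℝ d) else c) 0) = 0 := by
      simp [FunctionSpaces.Torus.kineticEnergy]
    rw [h1, Ioo_self, Measure.restrict_empty, lintegral_zero_measure, ENNReal.toReal_zero,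
      mul_zero, zero_add, intervalIntegral.integral_same, add_zero]
    exact FunctionSpaces.Torus.kineticEnergy_nonneg _
  energy_ineq_ae := by
    rw [Ioo_self, Measure.restrict_empty, ae_zero]
    exact eventually_bot
  weak_continuous := by
    intro w _
    refine ⟨by rw [Ioc_self]; exact continuousOn_empty _, ?_⟩
    have h : (fun t : ℝ => ∫ x, ⟪(fun (t : ℝ) (_ : UnitAddTorus d) => if t = 0 then (0 : EuclideanSpace ℝ d) else c) t x, w x⟫) =ᶠ[𝓝[>] 0]
        fun _ => ∫ x, ⟪c, w x⟫ := by
      filter_upwards [self_mem_nhdsWithin] with t ht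
      have ht0 : t ≠ 0 := ne_of_gt ht
      simp only [if_neg ht0]
    exact tendsto_const_nhds.congr' h.symm
  strong_initial := by
    have h : (fun t : ℝ => eLpNorm ((fun (t : ℝ) (_ : UnitAddTorus d) => if t = 0 then (0 : EuclideanSpace ℝ d) else c) t - fun _ => c) 2 volume) =ᶠ[𝓝[>] 0]
        fun _ => 0 := by
      filter_upwards [self_mem_nhdsWithin] with t ht
      have ht0 : t ≠ 0 := ne_of_gt ht
      have hsub : ((fun (t : ℝ) (_ : UnitAddTorus d) => if t = 0 then (0 : EuclideanSpace ℝ d) else c) t - fun _ => c) = 0 := by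
        funext x
        simp [if_neg ht0]
      rw [hsub, eLpNorm_zero]
    exact tendsto_const_nhds.congr' h.symm

/-! ### The refutation -/

-- names the `@[deprecated]` record `lions_energy_equality` of `DuchonRobert.lean` on purpose: this IS its
-- refutation (verdict clean-up 2026-08-16); REMOVE-WHEN the record is deleted from `DuchonRobert.lean`
set_option linter.deprecated false in
/-- **`lions_energy_equality` fails** at `T = 0`, `f = 0`, `u =` the jump flow, `u₀ = c` for
every `c ≠ 0` and `ν ≥ 0`: all hypotheses hold (`isLerayHopfOn_jumpFlow`; the mixed
classes over `Ioo 0 0 = ∅` are trivial) while the conclusion at `t = 0 ∈ Icc 0 0` reads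
`kineticEnergy 0 = kineticEnergy c`, i.e. `0 = ½‖c‖²`. [folklore] -/
theorem not_lions_energy_equality {c : EuclideanSpace ℝ d} (hc : c ≠ 0) {ν : ℝ} (hν : 0 ≤ ν) :
    ¬ lions_energy_equality (d := d) (T := 0) (ν := ν) (f := 0) (u := (fun (t : ℝ) (_ : UnitAddTorus d) => if t = 0 then (0 : EuclideanSpace ℝ d) else c))
      (u₀ := fun _ => c) := by
  intro h
  have key := h (isLerayHopfOn_jumpFlow ν c) hν (memLqLp_Ioo_self 4 4 _ 0)
    (memLqLp_Ioo_self 1 2 _ 0) 0 ⟨le_rfl, le_rfl⟩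
  have h1 : FunctionSpaces.Torus.kineticEnergy ((fun (t : ℝ) (_ : UnitAddTorus d) => if t = 0 then (0 : EuclideanSpace ℝ d) else c) 0) = 0 := by
    simp [FunctionSpaces.Torus.kineticEnergy]
  have h2 : FunctionSpaces.Torus.kineticEnergy (fun _ : UnitAddTorus d => c) = 2⁻¹ * ‖c‖ ^ 2 := by
    simp [FunctionSpaces.Torus.kineticEnergy]
  rw [h1, h2, Ioo_self, Measure.restrict_empty, lintegral_zero_measure, ENNReal.toReal_zero,
    mul_zero, zero_add, intervalIntegral.integral_same, add_zero] at key
  have : ‖c‖ ^ 2 = 0 := by linarith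
  exact hc (norm_eq_zero.1 (pow_eq_zero_iff two_ne_zero |>.1 this))

-- names the `@[deprecated]` record `lions_energy_equality` of `DuchonRobert.lean` on purpose: this IS its
-- refutation (verdict clean-up 2026-08-16); REMOVE-WHEN the record is deleted from `DuchonRobert.lean`
set_option linter.deprecated false in
/-- **The universal closure of `lions_energy_equality` is false** — the statement a discharge
`lions_energy_equality_holds : lions_energy_equality` would prove (all implicit arguments
generalised) fails on `T³` with `ν = 1`, `T = 0`, `f = 0`, datum the unit constant field `e₀`
and the jump flow. [folklore] -/
theorem not_forall_lions_energy_equality :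
    ¬ ∀ (T ν : ℝ) (f u : ℝ → UnitAddTorus (Fin 3) → EuclideanSpace ℝ (Fin 3))
        (u₀ : UnitAddTorus (Fin 3) → EuclideanSpace ℝ (Fin 3)),
        lions_energy_equality (T := T) (ν := ν) (f := f) (u := u) (u₀ := u₀) := by
  intro h
  have hc : (EuclideanSpace.single (0 : Fin 3) (1 : ℝ)) ≠ 0 := fun h0 => by
    have h1 := congrArg (fun v : EuclideanSpace ℝ (Fin 3) => v 0) h0
    simp at h1
  exact not_lions_energy_equality hc zero_le_one (h 0 1 0 _ _)

/-! ### Positive horizons: the steady constant flow redefined at `t = 0` -/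

/-- **The steady constant flow is a classical solution** of the unforced Navier–Stokes / Euler
system on all of `ℝ × T^d`, with zero pressure (every term of the momentum equation vanishes). [folklore] -/
theorem isClassicalNSSolutionOn_const (ν : ℝ) (c : EuclideanSpace ℝ d) :
    FunctionSpaces.Torus.IsClassicalNSSolutionOn univ ν 0 (fun (_ : ℝ) (_ : UnitAddTorus d) => c) 0 where
  smooth_velocity := by
    unfold FunctionSpaces.Torus.IsSmoothSpaceTimeOn FunctionSpaces.Torus.stLift
    exact contDiffOn_const
  smooth_pressure := by
    unfold FunctionSpaces.Torus.IsSmoothSpaceTimeOn FunctionSpaces.Torus.stLift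
    exact contDiffOn_const
  momentum := by
    intro t _ x
    have hl : FunctionSpaces.Torus.liftAt (fun _ : UnitAddTorus d => c) x = fun _ => c := rfl
    have hl0 : FunctionSpaces.Torus.liftAt (0 : UnitAddTorus d → ℝ) x = fun _ => (0 : ℝ) := rfl
    have h1 : FunctionSpaces.Torus.timeDerivWithin univ (fun (_ : ℝ) (_ : UnitAddTorus d) => c) t x = 0 := by
      simp [FunctionSpaces.Torus.timeDerivWithin]
    have h2 : FunctionSpaces.Torus.convect (fun _ : UnitAddTorus d => c) (fun _ => c) x = 0 := by
      simp [FunctionSpaces.Torus.convect, FunctionSpaces.Torus.fderiv, hl]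
    have h3 : FunctionSpaces.Torus.laplacian (fun _ : UnitAddTorus d => c) x = 0 := by
      simp [FunctionSpaces.Torus.laplacian, hl]
    have h4 : FunctionSpaces.Torus.gradient (0 : UnitAddTorus d → ℝ) x = 0 := by
      simp [FunctionSpaces.Torus.gradient, hl0, gradient]
    rw [h1, h2, h3]
    simp [h4]
  divFree := by
    intro t _ x
    simp [FunctionSpaces.Torus.divergence, FunctionSpaces.Torus.partialDeriv,
      FunctionSpaces.Torus.lineDeriv]

/-- **The steady constant flow is a Leray–Hopf solution** on `T^d × [0, T)` for every `T > 0`,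
any viscosity, zero force, datum `c` (classical solutions are Leray–Hopf,
`Torus.IsClassicalNSSolutionOn.isLerayHopfOn_of_convex`). [folklore] -/
theorem isLerayHopfOn_const {T : ℝ} (hT : 0 < T) (ν : ℝ) (c : EuclideanSpace ℝ d) :
    Torus.IsLerayHopfOn T ν 0 (fun _ => c) (fun (_ : ℝ) (_ : UnitAddTorus d) => c) :=
  (isClassicalNSSolutionOn_const ν c).isLerayHopfOn_of_convex convex_univ hT (subset_univ _)

/-- **The jump flow is a Leray–Hopf solution on every horizon `[0, T)`, `T > 0`**, with datum
`c`, any viscosity and zero force: it agrees with the steady constant flow at every time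
`t ≠ 0`, and no clause of `Torus.IsLerayHopfOn` sees the slice `t = 0` except `memLp`
(`0 ∈ L²`) and `energy_ineq_zero` at `t = 0` (`0 ≤ ½‖c‖²`). [folklore] -/
theorem isLerayHopfOn_jumpFlow_of_pos {T : ℝ} (hT : 0 < T) (ν : ℝ) (c : EuclideanSpace ℝ d) :
    Torus.IsLerayHopfOn T ν 0 (fun _ => c) (fun (t : ℝ) (_ : UnitAddTorus d) => if t = 0 then (0 : EuclideanSpace ℝ d) else c) := by
  have h := isLerayHopfOn_const hT ν c
  -- the work of the zero force vanishes for every field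
  have hwork : ∀ (v : ℝ → UnitAddTorus d → EuclideanSpace ℝ d) (a b : ℝ),
      ∫ τ in a..b, ∫ x, ⟪(0 : ℝ → UnitAddTorus d → EuclideanSpace ℝ d) τ x, v τ x⟫ = 0 := by
    intro v a b
    simp
  -- the dissipation does not see the slice `t = 0`
  have hdiss : ∀ {a b : ℝ}, 0 ≤ a →
      (∫⁻ τ in Ioo a b, FunctionSpaces.Torus.eGradNormSq ((fun (t : ℝ) (_ : UnitAddTorus d) => if t = 0 then (0 : EuclideanSpace ℝ d) else c) τ)) =
        ∫⁻ τ in Ioo a b, FunctionSpaces.Torus.eGradNormSq (fun _ : UnitAddTorus d => c) := fun ha =>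
    setLIntegral_congr_fun measurableSet_Ioo fun τ hτ => by
      simp only [if_neg (ha.trans_lt hτ.1).ne']
  refine ⟨?_, ?_, ?_, ?_, ?_, ?_, ?_, ?_⟩
  · obtain ⟨hm, h2, hdiv, hid⟩ := h.weak
    refine ⟨?_, ?_, ?_, ?_⟩
    · refine hm.congr ?_
      refine (ae_restrict_iff' (measurableSet_Ioo.prod MeasurableSet.univ)).2 (ae_of_all _ ?_)
      rintro ⟨t, y⟩ ⟨ht, -⟩
      have ht0 : t ≠ 0 := ne_of_gt ht.1
      simp [FunctionSpaces.Torus.stLift, ht0]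
    · refine lt_of_le_of_lt (le_of_eq ?_) h2
      exact setLIntegral_congr_fun measurableSet_Ioo fun t ht => by simp only [if_neg ht.1.ne']
    · filter_upwards [hdiv, ae_restrict_mem measurableSet_Ioo] with t h1 ht
      simpa only [if_neg ht.1.ne'] using h1
    · intro ψ hψ hψd
      have key := hid ψ hψ hψd
      convert key using 2
      exact setIntegral_congr_fun measurableSet_Ioo fun t ht => by simp only [if_neg ht.1.ne']
  · obtain ⟨C, hC⟩ := h.energy_bound
    exact ⟨C, by
      filter_upwards [hC, ae_restrict_mem measurableSet_Ioo] with t h1 ht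
      simpa only [if_neg ht.1.ne'] using h1⟩
  · exact fun t _ => memLp_const _
  · obtain ⟨h1, h2⟩ := h.memL2Sobolev
    refine ⟨?_, ?_⟩
    · filter_upwards [h1, ae_restrict_mem measurableSet_Ioo] with t h1 ht
      simpa only [if_neg ht.1.ne'] using h1
    · refine lt_of_le_of_lt (le_of_eq ?_) h2
      unfold FunctionSpaces.Torus.eL2SobolevNorm
      congr 1
      exact setLIntegral_congr_fun measurableSet_Ioo fun t ht => by simp only [if_neg ht.1.ne']
  · intro t ht
    rcases ht.1.eq_or_lt with rfl | ht0
    · have h1 : FunctionSpaces.Torus.kineticEnergy ((fun (t : ℝ) (_ : UnitAddTorus d) => if t = 0 then (0 : EuclideanSpace ℝ d) else c) 0) = 0 := by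
        simp [FunctionSpaces.Torus.kineticEnergy]
      rw [h1, Ioo_self, Measure.restrict_empty, lintegral_zero_measure, ENNReal.toReal_zero,
        mul_zero, zero_add, intervalIntegral.integral_same, add_zero]
      exact FunctionSpaces.Torus.kineticEnergy_nonneg _
    · have key := h.energy_ineq_zero t ht
      rw [hwork] at key
      rw [hwork, hdiss le_rfl]
      simp only [if_neg ht0.ne']
      exact key
  · filter_upwards [h.energy_ineq_ae, ae_restrict_mem measurableSet_Ioo] with s hs hsI
    intro t ht
    have ht0 : 0 < t := hsI.1.trans_le ht.1
    have key := hs t ht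
    rw [hwork] at key
    rw [hwork, hdiss hsI.1.le]
    simp only [if_neg ht0.ne', if_neg hsI.1.ne']
    exact key
  · intro w hw
    obtain ⟨hc1, hc2⟩ := h.weak_continuous w hw
    refine ⟨hc1.congr fun t ht => by simp only [if_neg ht.1.ne'], ?_⟩
    refine hc2.congr' ?_
    filter_upwards [self_mem_nhdsWithin] with t ht
    have ht0 : t ≠ 0 := ne_of_gt ht
    simp only [if_neg ht0]
  · refine h.strong_initial.congr' ?_
    filter_upwards [self_mem_nhdsWithin] with t ht
    have ht0 : t ≠ 0 := ne_of_gt ht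
    simp only [if_neg ht0]

-- names the `@[deprecated]` record `lions_energy_equality` of `DuchonRobert.lean` on purpose: this IS its
-- refutation (verdict clean-up 2026-08-16); REMOVE-WHEN the record is deleted from `DuchonRobert.lean`
set_option linter.deprecated false in
/-- **`lions_energy_equality` fails on every positive horizon**: for `T > 0`, `ν ≥ 0`, `c ≠ 0`
the instance `f = 0`, `u =` the jump flow (the steady constant flow with the slice `t = 0`
redefined to `0`),
`u₀ = c` is false — the hypotheses hold (`isLerayHopfOn_jumpFlow_of_pos`; a bounded field lies
in `L⁴(0,T; L⁴)`, the zero force in `L¹(0,T; L²)`), while the conclusion at `t = 0 ∈ Icc 0 T`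
reads `0 = ½‖c‖²`. So the defect is not the degenerate horizon but the unconstrained slice
`u 0`. [folklore] -/
theorem not_lions_energy_equality_of_pos {T : ℝ} (hT : 0 < T) {c : EuclideanSpace ℝ d} (hc : c ≠ 0)
    {ν : ℝ} (hν : 0 ≤ ν) :
    ¬ lions_energy_equality (d := d) (T := T) (ν := ν) (f := 0) (u := (fun (t : ℝ) (_ : UnitAddTorus d) => if t = 0 then (0 : EuclideanSpace ℝ d) else c))
      (u₀ := fun _ => c) := by
  intro h
  haveI : IsFiniteMeasure (volume.restrict (Ioo (0 : ℝ) T)) :=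
    ⟨by rw [Measure.restrict_apply_univ]; exact measure_Ioo_lt_top⟩
  -- `u ∈ L⁴(0,T; L⁴)`: every slice is a constant field on a probability space
  have hu4 : Torus.MemLqLp 4 4 (fun (t : ℝ) (_ : UnitAddTorus d) => if t = 0 then (0 : EuclideanSpace ℝ d) else c) (Ioo 0 T) := by
    refine ⟨ae_of_all _ fun t => memLp_const _, ?_⟩
    rw [FluidPDE.eLqLpNorm_def]
    have hg : (fun t : ℝ => (eLpNorm ((fun (t : ℝ) (_ : UnitAddTorus d) => if t = 0 then (0 : EuclideanSpace ℝ d) else c) t) 4 volume).toReal) =ᵐ[volume.restrict (Ioo 0 T)]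
        fun _ => (eLpNorm (fun _ : UnitAddTorus d => c) 4 volume).toReal := by
      filter_upwards [ae_restrict_mem measurableSet_Ioo] with t ht
      simp only [if_neg ht.1.ne']
    rw [eLpNorm_congr_ae hg]
    exact (memLp_const _).eLpNorm_lt_top
  -- `f = 0 ∈ L¹(0,T; L²)`
  have hf : Torus.MemLqLp 1 2 (0 : ℝ → UnitAddTorus d → EuclideanSpace ℝ d) (Ioo 0 T) := by
    refine ⟨ae_of_all _ fun t => ?_, ?_⟩
    · rw [Pi.zero_apply]
      exact MemLp.zero
    · rw [FluidPDE.eLqLpNorm_zero]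
      exact ENNReal.zero_lt_top
  have key := h (isLerayHopfOn_jumpFlow_of_pos hT ν c) hν hu4 hf 0 ⟨le_rfl, hT.le⟩
  have h1 : FunctionSpaces.Torus.kineticEnergy ((fun (t : ℝ) (_ : UnitAddTorus d) => if t = 0 then (0 : EuclideanSpace ℝ d) else c) 0) = 0 := by
    simp [FunctionSpaces.Torus.kineticEnergy]
  have h2 : FunctionSpaces.Torus.kineticEnergy (fun _ : UnitAddTorus d => c) = 2⁻¹ * ‖c‖ ^ 2 := by
    simp [FunctionSpaces.Torus.kineticEnergy]
  rw [h1, h2, Ioo_self, Measure.restrict_empty, lintegral_zero_measure, ENNReal.toReal_zero,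
    mul_zero, zero_add, intervalIntegral.integral_same, add_zero] at key
  have : ‖c‖ ^ 2 = 0 := by linarith
  exact hc (norm_eq_zero.1 (pow_eq_zero_iff two_ne_zero |>.1 this))

-- names the `@[deprecated]` record `lions_energy_equality` of `DuchonRobert.lean` on purpose: this IS its
-- refutation (verdict clean-up 2026-08-16); REMOVE-WHEN the record is deleted from `DuchonRobert.lean`
set_option linter.deprecated false in
/-- **The universal closure fails on every positive horizon too**: on `T³` with `ν = 1`, `T = 1`,
`f = 0`, the jump flow and the unit constant datum. [folklore] -/
theorem not_forall_lions_energy_equality_pos :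
    ¬ ∀ (f u : ℝ → UnitAddTorus (Fin 3) → EuclideanSpace ℝ (Fin 3))
        (u₀ : UnitAddTorus (Fin 3) → EuclideanSpace ℝ (Fin 3)),
        lions_energy_equality (T := 1) (ν := 1) (f := f) (u := u) (u₀ := u₀) := by
  intro h
  have hc : (EuclideanSpace.single (0 : Fin 3) (1 : ℝ)) ≠ 0 := fun h0 => by
    have h1 := congrArg (fun v : EuclideanSpace ℝ (Fin 3) => v 0) h0
    simp at h1
  exact not_lions_energy_equality_of_pos one_pos hc zero_le_one (h 0 _ _)

end Literature.Analysis.FluidPDE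

end
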